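import Summits.PneNP.PneNP.Theorems.ChebyshevTracialDesignJuntaMatchingLaw
import Literature.Computability.Complexity.KnapsackSosDegree
import Literature.Combinatorics.AssociationSchemes.JohnsonHarmonics
import HarnessLib

/-!
# Cell pnp-psdrank, route `ChebyshevTracialDesign`: the virtual level is integration against a fixed signed kernel

Support file for the crux `TracialDecayExp20` (stmt-PneNP-19878), engine seat (eng g9, MEMO-9 §1). Grigoriev's knapsack
pseudo-expectation around a perfect matching `M` of `S` (`|S| = 2|M|`), in the tree's closure convention
`Ẽ_M[ζ_A] = knapsackMoment |M| (t/2) x_M(A)` with `x_M(A) = #{e ∈ M : e meets A}` (bricks G/14: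
`…Junta.subset_event_poly`, `…LowDegreePricing.lowDegree_rectangle_value_eq`), satisfies the SUPERSET IDENTITY

  `Σ_{U ⊆ S, |U| = t, A ⊆ U} knapsackMoment |M| (t/2) x_M(U) = knapsackMoment |M| (t/2) x_M(A)`   (`sum_supersets_knapsackMoment`)

for every `A ⊆ S` with `|A| ≤ t` (downward induction on `|A|`: a vertex `v ∉ A` either lies on one of the `x_M(A)` edges meeting
`A` — `2x_M(A) − |A|` such vertices, `x` unchanged — or not — `2|M| − 2x_M(A)` vertices, `x ↦ x + 1` — and
`(2x − |A|)·K(x) + (2|M| − 2x)·K(x+1) = (t − |A|)·K(x)` by the knapsack recurrence `(|M| − x)K(x+1) = (t/2 − x)K(x)`;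
the case `x = |M|` cannot occur below `|A| < t ≤ |M|` since at most `|A|` edges meet `A`, `…Junta.card_filter_meets_le`).
Consequently the virtual value of ANY multilinear test function `f = zeta q` (coefficients supported on sets of size `≤ t`)
is integration of `f` against the fixed signed level kernel `κ_M(U) = knapsackMoment |M| (t/2) x_M(U)` on the `t`-cuts
(`virtual_value_eq_sum_cuts`): `Σ_A q_A·K(x_M(A)) = Σ_{|U| = t} f(U)·K(x_M(U))`; for a `t`-cut, `x_M(U) = t − e(U,M)` with
`e(U,M)` the number of internal edges, so `κ_M` is a function of the level alone (eng MEMO-9: `κ_M·#level = ` the Lagrange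
extrapolation weights from the levels to the virtual point `e = t/2`). No definitions. [cite: Grigoriev2001, Lemma 1.4 (PDF p. 8)]
Stature: support/instrument. WHAT THIS IS NOT: not virtual positivity, nothing on psd rank, no P-vs-NP content.
-/

set_option linter.dupNamespace false -- `Summit.PneNP.PneNP.…`: summit = sub-problem (D-0017)

noncomputable section

namespace Summit.PneNP.PneNP.Theorems.ChebyshevTracialDesignVirtualKernel

open Finset Literature.Barriers.PneNP Literature.Computability.Complexity
open Literature.Combinatorics.SimpleGraph.CycleSpace
open Literature.Combinatorics.AssociationSchemes.JohnsonHarmonics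
open Summit.PneNP.PneNP.Theorems.ChebyshevTracialDesignJunta

variable {V : Type*} [DecidableEq V]

/-- Adding a vertex `v ∈ S` to `A`: the edges of a perfect matching meeting `insert v A` are those meeting `A` together with
the edge at `v`; their number grows by one exactly when no edge meeting `A` contains `v`. [folklore] -/
theorem card_meet_insert {S : Finset V} {M : Finset (Sym2 V)} (hM : IsPMOn S M) (A : Finset V) {v : V} (hv : v ∈ S) :
    (M.filter fun e => ∃ a ∈ insert v A, a ∈ e).card =
      (M.filter fun e => ∃ a ∈ A, a ∈ e).card +
        (if ∃ e ∈ M.filter (fun e => ∃ a ∈ A, a ∈ e), v ∈ e then 0 else 1) := by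
  classical
  obtain ⟨e₀, he₀, hve₀⟩ := hM.exists_mem hv
  have hset : (M.filter fun e => ∃ a ∈ insert v A, a ∈ e) = insert e₀ (M.filter fun e => ∃ a ∈ A, a ∈ e) := by
    ext e
    simp only [mem_filter, mem_insert, exists_eq_or_imp]
    constructor
    · rintro ⟨he, h | ⟨a, ha, hae⟩⟩
      · exact Or.inl (hM.unique he he₀ h hve₀)
      · exact Or.inr ⟨he, a, ha, hae⟩
    · rintro (rfl | ⟨he, a, ha, hae⟩)
      · exact ⟨he₀, Or.inl hve₀⟩
      · exact ⟨he, Or.inr ⟨a, ha, hae⟩⟩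
  rw [hset]
  by_cases h : ∃ e ∈ M.filter (fun e => ∃ a ∈ A, a ∈ e), v ∈ e
  · rw [if_pos h]
    obtain ⟨e, he, hve⟩ := h
    have : e = e₀ := hM.unique (mem_filter.1 he).1 he₀ hve hve₀
    subst this
    rw [insert_eq_of_mem he, add_zero]
  · rw [if_neg h, card_insert_of_notMem]
    intro he₀'
    exact h ⟨e₀, he₀', hve₀⟩

/-- The vertices covered by the edges meeting `A` number `2·x_M(A)`, and they contain `A`. [folklore] -/
theorem card_covered_eq {S : Finset V} {M : Finset (Sym2 V)} (hM : IsPMOn S M) {A : Finset V} (hA : A ⊆ S) :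
    (S.filter fun v => ∃ e ∈ M.filter (fun e => ∃ a ∈ A, a ∈ e), v ∈ e).card =
        2 * (M.filter fun e => ∃ a ∈ A, a ∈ e).card ∧
      A ⊆ S.filter fun v => ∃ e ∈ M.filter (fun e => ∃ a ∈ A, a ∈ e), v ∈ e := by
  refine ⟨(two_mul_card_eq (isPMOn_verts hM (filter_subset _ M))).symm, fun a ha => ?_⟩
  obtain ⟨e, he, hae⟩ := hM.exists_mem (hA ha)
  exact mem_filter.2 ⟨hA ha, e, mem_filter.2 ⟨he, a, ha, hae⟩, hae⟩

/-- **Superset identity for Grigoriev's knapsack moments in the closure convention.** For a perfect matching `M` of `S`,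
`A ⊆ S`, and `|A| ≤ t`:  `Σ_{U ⊆ S, |U| = t, A ⊆ U} K(x_M(U)) = K(x_M(A))`, `K(x) = knapsackMoment |M| (t/2) x`,
`x_M(B) = #{e ∈ M : e meets B}`. [cite: Grigoriev2001, Lemma 1.4 (PDF p. 8)] -/
theorem sum_supersets_knapsackMoment {S : Finset V} {M : Finset (Sym2 V)} (hM : IsPMOn S M) {t : ℕ}
    (ht : t ≤ M.card) :
    ∀ (k : ℕ) (A : Finset V), A ⊆ S → A.card + k = t →
      ∑ U ∈ S.powerset.filter (fun U => U.card = t ∧ A ⊆ U),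
          knapsackMoment M.card ((t : ℝ) / 2) (M.filter fun e => ∃ a ∈ U, a ∈ e).card =
        knapsackMoment M.card ((t : ℝ) / 2) (M.filter fun e => ∃ a ∈ A, a ∈ e).card := by
  classical
  intro k
  induction k with
  | zero =>
    intro A hA hk
    have hset : S.powerset.filter (fun U => U.card = t ∧ A ⊆ U) = {A} := by
      ext U
      simp only [mem_filter, mem_powerset, mem_singleton]
      constructor
      · rintro ⟨hU, hUt, hAU⟩
        exact (eq_of_subset_of_card_le hAU (by omega)).symm
      · rintro rfl
        exact ⟨hA, by omega, Subset.rfl⟩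
    rw [hset, sum_singleton]
  | succ k ih =>
    intro A hA hk
    -- abbreviations
    set K : ℕ → ℝ := fun x => knapsackMoment M.card ((t : ℝ) / 2) x with hK
    set xM : Finset V → ℕ := fun B => (M.filter fun e => ∃ a ∈ B, a ∈ e).card with hxM
    set F : Finset V → Finset (Finset V) := fun B => S.powerset.filter (fun U => U.card = t ∧ B ⊆ U) with hF
    -- double counting: (t - |A|) · Σ_{U ∈ F A} K(x U) = Σ_{v ∈ S \ A} Σ_{U ∈ F (insert v A)} K(x U)
    have hcount : ∀ U ∈ F A, ((U \ A).card : ℝ) = (k + 1 : ℕ) := by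
      intro U hU
      obtain ⟨-, hUt, hAU⟩ := mem_filter.1 hU
      have hle := card_le_card hAU
      have h1 : (U \ A).card = k + 1 := by rw [card_sdiff_of_subset hAU]; omega
      exact_mod_cast h1
    have hdc : ((k + 1 : ℕ) : ℝ) * ∑ U ∈ F A, K (xM U) = ∑ v ∈ S \ A, ∑ U ∈ F (insert v A), K (xM U) := by
      calc ((k + 1 : ℕ) : ℝ) * ∑ U ∈ F A, K (xM U)
          = ∑ U ∈ F A, ∑ v ∈ U \ A, K (xM U) := by
            rw [mul_sum]
            refine sum_congr rfl fun U hU => ?_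
            rw [sum_const, nsmul_eq_mul, hcount U hU]
        _ = ∑ v ∈ S \ A, ∑ U ∈ F (insert v A), K (xM U) := by
            refine sum_comm' fun U v => ?_
            simp only [hF, mem_filter, mem_powerset, mem_sdiff, insert_subset_iff]
            constructor
            · rintro ⟨⟨hUS, hUt, hAU⟩, hvU, hvA⟩
              exact ⟨⟨hUS, hUt, hvU, hAU⟩, hUS hvU, hvA⟩
            · rintro ⟨⟨hUS, hUt, hvU, hAU⟩, hvS, hvA⟩
              exact ⟨⟨hUS, hUt, hAU⟩, hvU, hvA⟩
    -- inner sums by induction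
    have hinner : ∀ v ∈ S \ A, ∑ U ∈ F (insert v A), K (xM U) = K (xM (insert v A)) := by
      intro v hv
      obtain ⟨hvS, hvA⟩ := mem_sdiff.1 hv
      exact ih (insert v A) (insert_subset hvS hA) (by rw [card_insert_of_notMem hvA]; omega)
    rw [sum_congr rfl hinner] at hdc
    -- split S \ A according to whether v is covered by an edge meeting A
    set E := M.filter (fun e => ∃ a ∈ A, a ∈ e) with hE
    set W := S.filter (fun v => ∃ e ∈ E, v ∈ e) with hW
    obtain ⟨hWcard, hAW⟩ := card_covered_eq hM hA
    have hx : xM A = E.card := rfl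
    have hsplit : ∑ v ∈ S \ A, K (xM (insert v A)) =
        ((W \ A).card : ℝ) * K (xM A) + ((S \ W).card : ℝ) * K (xM A + 1) := by
      have h1 : ∀ v ∈ S \ A, K (xM (insert v A)) = if v ∈ W then K (xM A) else K (xM A + 1) := by
        intro v hv
        obtain ⟨hvS, -⟩ := mem_sdiff.1 hv
        have := card_meet_insert hM A hvS
        simp only [hxM] at this ⊢
        by_cases hvW : v ∈ W
        · have hex : ∃ e ∈ M.filter (fun e => ∃ a ∈ A, a ∈ e), v ∈ e := (mem_filter.1 hvW).2
          rw [this, if_pos hex, if_pos hvW, add_zero]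
        · have hex : ¬ ∃ e ∈ M.filter (fun e => ∃ a ∈ A, a ∈ e), v ∈ e := fun h => hvW (mem_filter.2 ⟨hvS, h⟩)
          rw [this, if_neg hex, if_neg hvW]
      rw [sum_congr rfl h1, sum_ite, sum_const, sum_const, nsmul_eq_mul, nsmul_eq_mul]
      have hWS : W ⊆ S := filter_subset _ S
      have e1 : (S \ A).filter (fun v => v ∈ W) = W \ A := by
        ext v; simp only [mem_filter, mem_sdiff]; constructor
        · rintro ⟨⟨-, hvA⟩, hvW⟩; exact ⟨hvW, hvA⟩
        · rintro ⟨hvW, hvA⟩; exact ⟨⟨hWS hvW, hvA⟩, hvW⟩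
      have e2 : (S \ A).filter (fun v => ¬ v ∈ W) = S \ W := by
        ext v; simp only [mem_filter, mem_sdiff]; constructor
        · rintro ⟨⟨hvS, -⟩, hvW⟩; exact ⟨hvS, hvW⟩
        · rintro ⟨hvS, hvW⟩; exact ⟨⟨hvS, fun hvA => hvW (hAW hvA)⟩, hvW⟩
      rw [e1, e2]
    rw [hsplit] at hdc
    -- arithmetic: |W \ A| = 2x - |A|, |S \ W| = 2|M| - 2x, knapsack recurrence
    have hWA : ((W \ A).card : ℝ) = 2 * (E.card : ℝ) - A.card := by
      rw [card_sdiff_of_subset hAW, Nat.cast_sub (card_le_card hAW), hWcard]; push_cast; ring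
    have hSW : ((S \ W).card : ℝ) = 2 * (M.card : ℝ) - 2 * E.card := by
      rw [card_sdiff_of_subset (filter_subset _ S), Nat.cast_sub (card_le_card (filter_subset _ S)), hWcard,
        ← two_mul_card_eq hM]; push_cast; ring
    have hEM : E.card ≤ M.card := card_le_card (filter_subset _ M)
    have hrec : ((S \ W).card : ℝ) * K (xM A + 1) = (((t : ℝ)) - 2 * E.card) * K (xM A) := by
      rw [hSW, hx]
      rcases Nat.lt_or_ge E.card M.card with hlt | hge
      · have := knapsackMoment_recurrence M.card ((t : ℝ) / 2) hlt
        -- (|M| - x) K(x+1) + (x - t/2) K(x) = 0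
        have h2 : (2 * (M.card : ℝ) - 2 * E.card) * K (E.card + 1) = 2 * (((M.card : ℝ) - E.card) * K (E.card + 1)) := by ring
        rw [h2]
        have h3 : ((M.card : ℝ) - E.card) * K (E.card + 1) = ((t : ℝ) / 2 - E.card) * K E.card := by
          simp only [hK]; linarith
        rw [h3]; ring
      · -- impossible: all edges meet `A` forces `|A| ≥ |M| ≥ t`, but `|A| < t`
        exfalso
        have hle : E.card ≤ A.card := card_filter_meets_le hM A
        omega
    -- conclude: (k+1)·Σ = (2x − |A| + t − 2x)·K(x) = (t − |A|)·K(x) = (k+1)·K(x)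
    have hfin : ((k + 1 : ℕ) : ℝ) * ∑ U ∈ F A, K (xM U) = ((k + 1 : ℕ) : ℝ) * K (xM A) := by
      rw [hdc, hWA, hrec, hx]
      have hcast : ((t : ℝ)) - A.card = ((k + 1 : ℕ) : ℝ) := by
        have : ((A.card + (k + 1) : ℕ) : ℝ) = t := by exact_mod_cast hk
        push_cast at this ⊢; linarith
      linear_combination (K E.card) * hcast
    exact mul_left_cancel₀ (by positivity) hfin

/-- **The virtual value of any multilinear test function is integration against the signed kernel `K(x_M(U))` on the
`t`-cuts.** For a perfect matching `M` of `S` with `t ≤ |M|` and coefficients `q` supported on subsets of `S` of size `≤ t`: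
`Σ_{A ⊆ S} q_A · K(x_M(A)) = Σ_{U ⊆ S, |U| = t} (Σ_{A ⊆ U} q_A) · K(x_M(U))`. [cite: Grigoriev2001, Lemma 1.4 (PDF p. 8)] -/
theorem virtual_value_eq_sum_cuts {S : Finset V} {M : Finset (Sym2 V)} (hM : IsPMOn S M) {t : ℕ} (ht : t ≤ M.card)
    (q : Finset V → ℝ) (hq : ∀ A, (¬ A ⊆ S ∨ t < A.card) → q A = 0) :
    ∑ A ∈ S.powerset, q A * knapsackMoment M.card ((t : ℝ) / 2) (M.filter fun e => ∃ a ∈ A, a ∈ e).card =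
      ∑ U ∈ S.powersetCard t, (∑ A ∈ U.powerset, q A) *
        knapsackMoment M.card ((t : ℝ) / 2) (M.filter fun e => ∃ a ∈ U, a ∈ e).card := by
  classical
  -- expand the right-hand side and swap the sums
  have hswap : ∑ U ∈ S.powersetCard t, (∑ A ∈ U.powerset, q A) *
        knapsackMoment M.card ((t : ℝ) / 2) (M.filter fun e => ∃ a ∈ U, a ∈ e).card =
      ∑ A ∈ S.powerset, ∑ U ∈ S.powerset.filter (fun U => U.card = t ∧ A ⊆ U),
        q A * knapsackMoment M.card ((t : ℝ) / 2) (M.filter fun e => ∃ a ∈ U, a ∈ e).card := by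
    simp_rw [sum_mul]
    refine sum_comm' fun U A => ?_
    simp only [mem_powersetCard, mem_powerset, mem_filter]
    constructor
    · rintro ⟨⟨hUS, hUt⟩, hAU⟩
      exact ⟨⟨hUS, hUt, hAU⟩, hAU.trans hUS⟩
    · rintro ⟨⟨hUS, hUt, hAU⟩, -⟩
      exact ⟨⟨hUS, hUt⟩, hAU⟩
  rw [hswap]
  refine sum_congr rfl fun A hA => ?_
  rw [← mul_sum]
  by_cases hAt : A.card ≤ t
  · obtain ⟨k, hk⟩ : ∃ k, A.card + k = t := ⟨t - A.card, by omega⟩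
    rw [sum_supersets_knapsackMoment hM ht k A (mem_powerset.1 hA) hk]
  · rw [hq A (Or.inr (by omega)), zero_mul, zero_mul]

/-- For a `t`-cut `U` the number of matching edges meeting `U` is `t − e(U,M)` (`e` = internal edges): the meeting edges are the
crossing and the internal ones, and `t = cr + 2·in`. [folklore] -/
theorem card_meet_eq_cr_add_in {S U : Finset V} {M : Finset (Sym2 V)} (hM : IsPMOn S M) (hU : U ⊆ S) :
    (M.filter fun e => ∃ a ∈ U, a ∈ e).card =
      (M.filter fun e => cutCount U e = 1).card + (M.filter fun e => cutCount U e = 2).card ∧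
    U.card = (M.filter fun e => cutCount U e = 1).card + 2 * (M.filter fun e => cutCount U e = 2).card := by
  classical
  refine ⟨?_, card_eq_cr_add_two_mul_in hM hU⟩
  rw [← card_union_of_disjoint (disjoint_filter.2 fun e _ h1 h2 => by omega)]
  congr 1
  ext e
  simp only [mem_filter, mem_union]
  constructor
  · rintro ⟨he, a, haU, hae⟩
    have hle := cutCount_le_two U e
    have hpos : cutCount U e ≠ 0 := by
      induction e using Sym2.ind with
      | h x y =>
        rw [cutCount_mk]
        rcases Sym2.mem_iff.1 hae with rfl | rfl
        · rw [if_pos haU]; omega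
        · rw [if_pos haU]; omega
    by_cases h1 : cutCount U e = 1
    · exact Or.inl ⟨he, h1⟩
    · exact Or.inr ⟨he, by omega⟩
  · rintro (⟨he, h⟩ | ⟨he, h⟩)
    · refine ⟨he, ?_⟩
      induction e using Sym2.ind with
      | h x y =>
        rw [cutCount_mk] at h
        by_cases hx : x ∈ U
        · exact ⟨x, hx, Sym2.mem_mk_left x y⟩
        · rw [if_neg hx] at h
          by_cases hy : y ∈ U
          · exact ⟨y, hy, Sym2.mem_mk_right x y⟩
          · rw [if_neg hy] at h; simp at h
    · refine ⟨he, ?_⟩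
      induction e using Sym2.ind with
      | h x y =>
        rw [cutCount_mk] at h
        by_cases hx : x ∈ U
        · exact ⟨x, hx, Sym2.mem_mk_left x y⟩
        · rw [if_neg hx] at h
          by_cases hy : y ∈ U
          · exact ⟨y, hy, Sym2.mem_mk_right x y⟩
          · rw [if_neg hy] at h; simp at h

/-- **Cut form for `K_n`** (the vocabulary of brick 14, `…LowDegreePricing`): for a perfect matching `M` of `K_n`, `2t ≤ n`, and a
coefficient vector `q` supported on sets of size `≤ t`, Grigoriev's virtual value of `zeta q` is the integral of `zeta q` against the
signed kernel `U ↦ knapsackMoment |M| (t/2) x_M(U)` over the `t`-cuts: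
`Σ_A q_A · K(x_M(A)) = Σ_{|U| = t} (zeta q)(U) · K(x_M(U))`. [cite: Grigoriev2001, Lemma 1.4 (PDF p. 8)] -/
theorem virtual_value_eq_sum_cuts_univ {n : ℕ} (M : PMatch n) {t : ℕ} (ht : 2 * t ≤ n) (q : Finset (Fin n) → ℝ)
    (hq : ∀ A, t < A.card → q A = 0) :
    ∑ A : Finset (Fin n), q A * knapsackMoment M.1.card ((t : ℝ) / 2) (M.1.filter fun e => ∃ a ∈ A, a ∈ e).card =
      ∑ U ∈ (univ : Finset (Fin n)).powersetCard t,
        zeta q U * knapsackMoment M.1.card ((t : ℝ) / 2) (M.1.filter fun e => ∃ a ∈ U, a ∈ e).card := by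
  have hM : t ≤ M.1.card := by
    have h2 := two_mul_card_eq M.2
    rw [card_univ, Fintype.card_fin] at h2
    omega
  have h := virtual_value_eq_sum_cuts M.2 hM q (fun A hA => hq A (hA.resolve_left fun h => h (subset_univ A)))
  rw [powerset_univ] at h
  convert h with U hU; simp [zeta_apply]

/-- **Level form**: on the `t`-cuts the virtual kernel is a function of the LEVEL alone — with `in_M(U)` the number of matching edges
inside `U`, `x_M(U) = t − in_M(U)`, so Grigoriev's virtual value of `zeta q` is `Σ_{|U| = t} (zeta q)(U) · K(t − in_M(U))`
(eng MEMO-9 §1: `K(t − e)·#{U : in_M(U) = e}` are the Lagrange extrapolation weights from the levels `e = 0..(t−1)/2` to the virtual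
point `e = t/2`). [cite: Grigoriev2001, Lemma 1.4 (PDF p. 8)] -/
theorem virtual_value_eq_sum_cuts_level {n : ℕ} (M : PMatch n) {t : ℕ} (ht : 2 * t ≤ n) (q : Finset (Fin n) → ℝ)
    (hq : ∀ A, t < A.card → q A = 0) :
    ∑ A : Finset (Fin n), q A * knapsackMoment M.1.card ((t : ℝ) / 2) (M.1.filter fun e => ∃ a ∈ A, a ∈ e).card =
      ∑ U ∈ (univ : Finset (Fin n)).powersetCard t,
        zeta q U * knapsackMoment M.1.card ((t : ℝ) / 2) (t - (M.1.filter fun e => cutCount U e = 2).card) := by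
  rw [virtual_value_eq_sum_cuts_univ M ht q hq]
  refine sum_congr rfl fun U hU => ?_
  obtain ⟨-, hUt⟩ := mem_powersetCard.1 hU
  obtain ⟨hx, ht'⟩ := card_meet_eq_cr_add_in M.2 (subset_univ U)
  congr 2
  have hx' : (M.1.filter fun e => ∃ a ∈ U, a ∈ e).card =
      (M.1.filter fun e => cutCount U e = 1).card + (M.1.filter fun e => cutCount U e = 2).card := by convert hx using 3
  omega

/-! ### The kernel reproduces the binomial moments of the inner-edge count at the virtual point -/

/-- The edges of a perfect matching meeting the vertex set covered by a sub-matching `F ⊆ M` are exactly the edges of `F`. [folklore] -/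
theorem filter_meet_verts_eq {S : Finset V} {M F : Finset (Sym2 V)} (hM : IsPMOn S M) (hF : F ⊆ M) :
    (M.filter fun e => ∃ a ∈ S.filter (fun v => ∃ f ∈ F, v ∈ f), a ∈ e) = F := by
  ext e
  simp only [mem_filter]
  constructor
  · rintro ⟨he, a, ⟨-, f, hf, haf⟩, hae⟩
    rwa [hM.unique he (hF hf) hae haf]
  · intro he
    refine ⟨hF he, ?_⟩
    induction e using Sym2.ind with
    | h x y =>
      have hx : x ∈ S := hM.mem_of_mem (hF he) (Sym2.mem_mk_left x y)
      exact ⟨x, ⟨hx, s(x, y), he, Sym2.mem_mk_left x y⟩, Sym2.mem_mk_left x y⟩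

/-- `cutCount U e = 2` iff both endpoints of `e` lie in `U`. [folklore] -/
theorem cutCount_eq_two_iff (U : Finset V) (e : Sym2 V) : cutCount U e = 2 ↔ ∀ a ∈ e, a ∈ U := by
  induction e using Sym2.ind with
  | h x y =>
    rw [cutCount_mk]
    constructor
    · intro h a ha
      rcases Sym2.mem_iff.1 ha with rfl | rfl
      · by_contra hx; rw [if_neg hx] at h; split_ifs at h <;> omega
      · by_contra hy; rw [if_neg hy] at h; split_ifs at h <;> omega
    · intro h
      rw [if_pos (h x (Sym2.mem_mk_left x y)), if_pos (h y (Sym2.mem_mk_right x y))]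

/-- The `j`-subsets of internal edges: `C(in_M(U), j) = #{F ⊆ M : |F| = j, every edge of F inside U}`. [folklore] -/
theorem choose_card_filter_in_eq {M : Finset (Sym2 V)} (U : Finset V) (j : ℕ) :
    ((M.filter fun e => cutCount U e = 2).card.choose j) =
      ((M.powersetCard j).filter fun F => ∀ e ∈ F, cutCount U e = 2).card := by
  rw [← card_powersetCard]
  congr 1
  ext F
  simp only [mem_powersetCard, mem_filter, subset_iff]
  constructor
  · rintro ⟨hF, hc⟩
    exact ⟨⟨fun e he => (hF he).1, hc⟩, fun e he => (hF he).2⟩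
  · rintro ⟨⟨hF, hc⟩, h2⟩
    exact ⟨fun e he => ⟨hF he, h2 e he⟩, hc⟩

/-- **The virtual kernel reproduces the binomial moments of the inner-edge count at the virtual point** (Grigoriev's knapsack pseudo-moments
in level language): for a perfect matching `M` of `S`, `2j ≤ t ≤ |M|`:
`Σ_{U ⊆ S, |U| = t} K(x_M(U)) · C(in_M(U), j) = C(|M|, j) · K(j)`, `K(x) = knapsackMoment |M| (t/2) x` — i.e. with `ω_e := K(t−e)·#{U : in_M(U) = e}`,
`Σ_e ω_e C(e, j) = C(|M|, j)·Π_{i<j}(t/2 − i)/(|M| − i) = C(t/2, j)` for all `j ≤ (t−1)/2`: the weights `ω` reproduce every polynomial of degree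
`≤ (t−1)/2` in the level at the virtual point `e* = t/2` (they are the Lagrange extrapolation weights; eng MEMO-9 §1).
[cite: Grigoriev2001, Lemma 1.4 (PDF p. 8)] -/
theorem sum_cuts_kernel_mul_choose_in {S : Finset V} {M : Finset (Sym2 V)} (hM : IsPMOn S M) {t j : ℕ} (ht : t ≤ M.card)
    (hj : 2 * j ≤ t) :
    ∑ U ∈ S.powersetCard t, knapsackMoment M.card ((t : ℝ) / 2) (M.filter fun e => ∃ a ∈ U, a ∈ e).card *
        (((M.filter fun e => cutCount U e = 2).card.choose j : ℕ) : ℝ) =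
      (M.card.choose j : ℝ) * knapsackMoment M.card ((t : ℝ) / 2) j := by
  classical
  set K : ℕ → ℝ := fun x => knapsackMoment M.card ((t : ℝ) / 2) x with hK
  -- expand C(in, j) as a sum of indicators over j-subsets of M
  have hexp : ∀ U : Finset V, (((M.filter fun e => cutCount U e = 2).card.choose j : ℕ) : ℝ) =
      ∑ F ∈ M.powersetCard j, (if ∀ e ∈ F, cutCount U e = 2 then (1 : ℝ) else 0) := by
    intro U
    rw [choose_card_filter_in_eq U j, card_filter]
    push_cast
    rfl
  simp_rw [hexp, mul_sum, mul_ite, mul_one, mul_zero]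
  rw [sum_comm]
  -- for each j-subset F of M the inner sum is the superset sum over U ⊇ V(F)
  have hinner : ∀ F ∈ M.powersetCard j,
      ∑ U ∈ S.powersetCard t, (if ∀ e ∈ F, cutCount U e = 2 then K (M.filter fun e => ∃ a ∈ U, a ∈ e).card else 0) = K j := by
    intro F hF
    obtain ⟨hFM, hFj⟩ := mem_powersetCard.1 hF
    set W := S.filter (fun v => ∃ f ∈ F, v ∈ f) with hW
    have hWS : W ⊆ S := filter_subset _ S
    have hWE : IsPMOn W F := isPMOn_verts hM hFM
    have hWcard : W.card = 2 * j := by rw [← two_mul_card_eq hWE, hFj]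
    rw [← sum_filter]
    have hset : (S.powersetCard t).filter (fun U => ∀ e ∈ F, cutCount U e = 2) =
        S.powerset.filter (fun U => U.card = t ∧ W ⊆ U) := by
      ext U
      simp only [mem_filter, mem_powersetCard, mem_powerset, hW, subset_iff]
      constructor
      · rintro ⟨⟨hUS, hUt⟩, h2⟩
        refine ⟨hUS, hUt, fun v hv => ?_⟩
        obtain ⟨-, f, hf, hvf⟩ := hv
        exact (cutCount_eq_two_iff U f).1 (h2 f hf) v hvf
      · rintro ⟨hUS, hUt, hWU⟩
        refine ⟨⟨hUS, hUt⟩, fun f hf => (cutCount_eq_two_iff U f).2 fun a ha => hWU ?_⟩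
        exact ⟨hM.mem_of_mem (hFM hf) ha, f, hf, ha⟩
    rw [hset]
    obtain ⟨k, hk⟩ : ∃ k, W.card + k = t := ⟨t - W.card, by omega⟩
    rw [sum_supersets_knapsackMoment hM ht k W hWS hk, filter_meet_verts_eq hM hFM, hFj]
  rw [sum_congr rfl hinner, sum_const, card_powersetCard, nsmul_eq_mul]

end Summit.PneNP.PneNP.Theorems.ChebyshevTracialDesignVirtualKernel
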